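import Summits.QuantumFields.QCD.Theorems.QuarksAsStableActionStableActionBridgeDefs
import Literature.MathematicalPhysics.QuantumFieldTheory.QCDTransferMatrix
import HarnessLib

/-!
# Reshape / decomposition file for stub `stub_thermalComparison` (crux stmt-QuantumFields-11525 `ConvergentOSClosure`, line birth)

Worker analysis file (NOT a tree file; no `sorry`; every signature below elaborates).  Companion:
`stub_thermalComparison-analysis.md`.

COMP (the registered conclusion) compares the canonical distributions of the time-PERIODIC own-torus functional with
FORWARD insertions (`qcdLatticeDist`) and of the THERMAL (antiperiodic) functional with Θ-SYMMETRISED insertions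
(`qcdLatticeDistSymAP`).  It splits along the intermediate functional `qcdLatticeDistAP` (thermal quarks, forward
insertions; §1, the distribution form of line `twisted_trace_transfer`'s `qcdLatticeSchwingerThermal`):

* `ThermalBoundaryComparison sch s` (BC half; the ε-uniform E0′ form of 9737's registered OPEN stub
  `stub_schwingerComparison : SchwingerReturn`, which is only pointwise on real tensors);
* `DensitySymComparison sch s` (density half: forward corner density ↔ time-clover density under the thermal functional;
  unfiled anywhere; `O(a_k)` after a summation by parts in the glue slots, needs a k-uniform E0′ bound for ELECTRIC
  sub-density insertions);
* `comp_of_halves` (PROVED): BC half + density half ⇒ COMP verbatim (triangle inequality), `ePrimeClose_mono` (PROVED):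
  the comparison at Schwartz index `s` gives it at every `s' ≥ s`;
* `comp_of_z_eq_zero` (PROVED): for schemes with vanishing species renormalisations `z ≡ 0` both functionals vanish in
  positive degree, so COMP holds — the cheap degenerate witnesses cannot refute the stub;
* verbatim copies (primed names) of the two EXTRA hypotheses of `SchwingerReturn` that the crux hypotheses do not supply:
  `LowTemperaturePressureAt'` (thermal smallness / low-temperature pressure, typed spectrally over `qcdTransferLevel`) and
  `SubexponentialRenormalisation'` — the originals live in the sorry-carrying Lines file
  `Cruxes/StableActionBridge/Lines/twisted_trace_transfer.lean` (namespace `…StableActionBridge.TwistedTraceTransfer`).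
-/

noncomputable section

namespace Summit.QuantumFields.QCD.Theorems.ConvergentOSClosure

open scoped BigOperators Topology SchwartzMap
open MeasureTheory Filter
open Literature.MathematicalPhysics.AQFT Literature.MathematicalPhysics.QuantumLattice
  Literature.MathematicalPhysics.QuantumFieldTheory
open Literature.Probability.LatticeModels (box Site)
open Summit.QuantumFields.QCD.Cruxes.StableActionBridge.Sketch (renormInsertion renormInsertionSym qcdTorusMomentStr
  qcdTorusMomentSymAP qcdLatticeDist qcdLatticeDistSymAP qcdLatticeDist_zero_apply qcdLatticeDistSymAP_zero_apply
  qcdLatticeDist_apply qcdLatticeDistSymAP_apply)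

local notation "E4" => EuclideanSpace ℝ (Fin 4)

variable {Nf : ℕ}

/-! ## §1 The intermediate functional: THERMAL quarks, FORWARD insertions -/

/-- Thermal weight with FORWARD insertions: the `qcdTorusExpectAP`-expectation of the ordered product of the
renormalised centred (unsymmetrised) insertions. -/
def qcdTorusMomentAP (sch : QCDScheme Nf) (k : ℕ) {n : ℕ} (σ : Fin n → QCDField Nf) (x : Fin n → Site 4) : ℂ :=
  qcdTorusExpectAP (sch.β k) (sch.side k) (fun fl => sch.mq fl k)
    fun U => (List.ofFn fun i => renormInsertion sch k (σ i) (x i) U).prod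

/-- The thermal lattice `n`-point DISTRIBUTION with forward insertions (twin of `qcdLatticeDist` /
`qcdLatticeDistSymAP`; on real tensors it is `qcdLatticeSchwingerThermal` of line `twisted_trace_transfer`). -/
def qcdLatticeDistAP (sch : QCDScheme Nf) (k n : ℕ) (σ : Fin n → QCDField Nf) :
    𝓢((Fin n → E4), ℂ) →L[ℂ] ℂ :=
  if n = 0 then LabelledSchwingerFamily.evalAt default else
    ∑ x ∈ Fintype.piFinset (fun _ : Fin n => box 4 (sch.L k)),
      qcdTorusMomentAP sch k σ x • LabelledSchwingerFamily.evalAt (fun i => sch.a k • siteToE (x i))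

/-! ## §2 ε-uniform E0′-closeness of two families of lattice distributions -/

/-- `EPrimeClose Λ Λ' s`: for every `ε > 0`, arity and species string, eventually in `k`,
`‖Λ k n σ F − Λ' k n σ F‖ ≤ ε |F|_{ns}` for all `F ∈ ⁰𝒮` (the shape of COMP). -/
def EPrimeClose (Λ Λ' : ℕ → (n : ℕ) → (Fin n → QCDField Nf) → (𝓢((Fin n → E4), ℂ) →L[ℂ] ℂ)) (s : ℕ) : Prop :=
  ∀ ε : ℝ, 0 < ε → ∀ (n : ℕ) (σ : Fin n → QCDField Nf), ∀ᶠ k in atTop,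
    ∀ F : 𝓢((Fin n → E4), ℂ), IsOffDiagonal F → ‖Λ k n σ F - Λ' k n σ F‖ ≤ ε * schwartzNorm (n * s) F

theorem ePrimeClose_trans {Λ₁ Λ₂ Λ₃ : ℕ → (n : ℕ) → (Fin n → QCDField Nf) → (𝓢((Fin n → E4), ℂ) →L[ℂ] ℂ)} {s : ℕ}
    (h₁₂ : EPrimeClose Λ₁ Λ₂ s) (h₂₃ : EPrimeClose Λ₂ Λ₃ s) : EPrimeClose Λ₁ Λ₃ s := by
  intro ε hε n σ
  filter_upwards [h₁₂ (ε / 2) (half_pos hε) n σ, h₂₃ (ε / 2) (half_pos hε) n σ] with k hk₁ hk₂ F hF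
  calc ‖Λ₁ k n σ F - Λ₃ k n σ F‖ = ‖(Λ₁ k n σ F - Λ₂ k n σ F) + (Λ₂ k n σ F - Λ₃ k n σ F)‖ := by
        rw [sub_add_sub_cancel]
    _ ≤ ‖Λ₁ k n σ F - Λ₂ k n σ F‖ + ‖Λ₂ k n σ F - Λ₃ k n σ F‖ := norm_add_le _ _
    _ ≤ ε / 2 * schwartzNorm (n * s) F + ε / 2 * schwartzNorm (n * s) F := add_le_add (hk₁ F hF) (hk₂ F hF)
    _ = ε * schwartzNorm (n * s) F := by ring

theorem ePrimeClose_symm {Λ₁ Λ₂ : ℕ → (n : ℕ) → (Fin n → QCDField Nf) → (𝓢((Fin n → E4), ℂ) →L[ℂ] ℂ)} {s : ℕ}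
    (h : EPrimeClose Λ₁ Λ₂ s) : EPrimeClose Λ₂ Λ₁ s := by
  intro ε hε n σ
  filter_upwards [h ε hε n σ] with k hk F hF
  rw [norm_sub_rev]
  exact hk F hF

/-- The comparison at Schwartz index `s` gives it at every larger index (`|F|_{ns} ≤ |F|_{ns'}`). -/
theorem ePrimeClose_mono {Λ₁ Λ₂ : ℕ → (n : ℕ) → (Fin n → QCDField Nf) → (𝓢((Fin n → E4), ℂ) →L[ℂ] ℂ)} {s s' : ℕ}
    (hs : s ≤ s') (h : EPrimeClose Λ₁ Λ₂ s) : EPrimeClose Λ₁ Λ₂ s' := by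
  intro ε hε n σ
  filter_upwards [h ε hε n σ] with k hk F hF
  exact (hk F hF).trans (mul_le_mul_of_nonneg_left (schwartzNorm_mono (Nat.mul_le_mul_left n hs) F) hε.le)

/-! ## §3 The two halves of COMP and the recomposition -/

/-- **BC half** (periodic ↔ antiperiodic quarks, forward insertions on both sides), ε-uniform in the E0′ norm on `⁰𝒮`. -/
def ThermalBoundaryComparison (sch : QCDScheme Nf) (s : ℕ) : Prop :=
  EPrimeClose (qcdLatticeDistAP sch) (qcdLatticeDist sch) s

/-- **Density half** (Θ-symmetrised ↔ forward insertions, thermal quarks on both sides), ε-uniform in the E0′ norm. -/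
def DensitySymComparison (sch : QCDScheme Nf) (s : ℕ) : Prop :=
  EPrimeClose (qcdLatticeDistSymAP sch) (qcdLatticeDistAP sch) s

/-- **COMP from its two halves** (the conclusion of the registered `stub_thermalComparison`, verbatim). -/
theorem comp_of_halves (sch : QCDScheme Nf) (s : ℕ) (hbc : ThermalBoundaryComparison sch s)
    (hden : DensitySymComparison sch s) :
    ∀ ε : ℝ, 0 < ε → ∀ (n : ℕ) (σ : Fin n → QCDField Nf), ∀ᶠ k in Filter.atTop,
      ∀ F : SchwartzMap (Fin n → EuclideanSpace ℝ (Fin 4)) ℂ, IsOffDiagonal F →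
        ‖qcdLatticeDistSymAP sch k n σ F - qcdLatticeDist sch k n σ F‖ ≤ ε * schwartzNorm (n * s) F :=
  ePrimeClose_trans hden hbc

/-! ## §4 Degenerate schemes cannot refute COMP: `z ≡ 0` -/

/-- With vanishing species renormalisations every ordered product of `n ≥ 1` renormalised insertions vanishes. -/
theorem prod_renormInsertion_eq_zero (sch : QCDScheme Nf) (hz : ∀ s k, sch.z s k = 0) (k : ℕ) {n : ℕ} (hn : n ≠ 0)
    (σ : Fin n → QCDField Nf) (x : Fin n → Site 4)
    (U : GaugeConfig 4 (sch.side k) (Matrix.specialUnitaryGroup (Fin 3) ℂ)) :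
    (List.ofFn fun i => renormInsertion sch k (σ i) (x i) U).prod = 0 := by
  obtain ⟨m, rfl⟩ := Nat.exists_eq_succ_of_ne_zero hn
  rw [List.ofFn_succ, List.prod_cons]
  have h0 : renormInsertion sch k (σ 0) (x 0) U = 0 := by
    unfold renormInsertion
    rw [hz, zero_mul, Complex.ofReal_zero, zero_smul]
  rw [h0, zero_mul]

/-- Same for the Θ-symmetrised insertions. -/
theorem prod_renormInsertionSym_eq_zero (sch : QCDScheme Nf) (hz : ∀ s k, sch.z s k = 0) (k : ℕ) {n : ℕ} (hn : n ≠ 0)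
    (σ : Fin n → QCDField Nf) (x : Fin n → Site 4)
    (U : GaugeConfig 4 (sch.side k) (Matrix.specialUnitaryGroup (Fin 3) ℂ)) :
    (List.ofFn fun i => renormInsertionSym sch k (σ i) (x i) U).prod = 0 := by
  obtain ⟨m, rfl⟩ := Nat.exists_eq_succ_of_ne_zero hn
  rw [List.ofFn_succ, List.prod_cons]
  have h0 : renormInsertionSym sch k (σ 0) (x 0) U = 0 := by
    unfold renormInsertionSym
    rw [hz, zero_mul, Complex.ofReal_zero, zero_smul]
  rw [h0, zero_mul]

/-- **COMP holds for every scheme with `z ≡ 0`** (both distributions vanish in positive degree and agree in degree `0`). -/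
theorem comp_of_z_eq_zero (sch : QCDScheme Nf) (hz : ∀ s k, sch.z s k = 0) (s : ℕ) :
    ∀ ε : ℝ, 0 < ε → ∀ (n : ℕ) (σ : Fin n → QCDField Nf), ∀ᶠ k in Filter.atTop,
      ∀ F : SchwartzMap (Fin n → EuclideanSpace ℝ (Fin 4)) ℂ, IsOffDiagonal F →
        ‖qcdLatticeDistSymAP sch k n σ F - qcdLatticeDist sch k n σ F‖ ≤ ε * schwartzNorm (n * s) F := by
  intro ε hε n σ
  refine Eventually.of_forall fun k F _ => ?_
  have hrhs : 0 ≤ ε * schwartzNorm (n * s) F := mul_nonneg hε.le (schwartzNorm_nonneg _ _)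
  rcases Nat.eq_zero_or_pos n with rfl | hn
  · rw [qcdLatticeDistSymAP_zero_apply, qcdLatticeDist_zero_apply, sub_self, norm_zero]
    exact hrhs
  · have h1 : qcdLatticeDistSymAP sch k n σ F = 0 := by
      rw [qcdLatticeDistSymAP_apply sch k hn.ne' σ F]
      refine Finset.sum_eq_zero fun x _ => ?_
      have hw : qcdTorusMomentSymAP sch k σ x = 0 := by
        unfold qcdTorusMomentSymAP qcdTorusExpectAP
        simp only [prod_renormInsertionSym_eq_zero sch hz k hn.ne' σ x, zero_mul, map_zero, integral_zero, zero_div]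
      rw [hw, zero_mul]
    have h2 : qcdLatticeDist sch k n σ F = 0 := by
      rw [qcdLatticeDist_apply sch k hn.ne' σ F]
      refine Finset.sum_eq_zero fun x _ => ?_
      have hw : qcdTorusMomentStr sch k σ x = 0 := by
        unfold qcdTorusMomentStr
        simp only [prod_renormInsertion_eq_zero sch hz k hn.ne' σ x, zero_mul, map_zero, integral_zero, zero_div]
      rw [hw, zero_mul]
    rw [h1, h2, sub_self, norm_zero]
    exact hrhs

/-! ## §5 The two extra hypotheses of 9737's `SchwingerReturn` that the crux hypotheses do not supply
(verbatim copies of `…TwistedTraceTransfer.thermalRatio / LowTemperaturePressureAt / SubexponentialRenormalisation`) -/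

/-- Boltzmann ratio `λ_{n+1}/λ₀` of the min–max levels of Lüscher's transfer operator on the spatial torus `2S+1`. -/
def thermalRatio' (sch : QCDScheme Nf) (k S n : ℕ) : ℝ :=
  qcdTransferLevel Nf (2 * S + 1) (sch.β k) (fun fl => sch.mq fl k) (n + 1) /
    qcdTransferLevel Nf (2 * S + 1) (sch.β k) (fun fl => sch.mq fl k) 0

/-- **Low-temperature pressure at rate `Δth`** (thermal smallness): `Σ_{i≥1} (λᵢ/λ₀)^t ≤ C e^{−Δth a_k t}` for `t ≥ θS`,
`S ≥ L_k`, every `θ > 0`, eventually in `k`.  NOT implied by a spectral gap / `HasLatticeMassGap` (entropy). -/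
def LowTemperaturePressureAt' (sch : QCDScheme Nf) (Δth : ℝ) : Prop :=
  ∀ θ : ℝ, 0 < θ → ∃ C : ℝ, ∀ᶠ k in atTop, ∀ S : ℕ, sch.L k ≤ S → ∀ t : ℕ, θ * S ≤ t →
    ∀ M : ℕ, (∑ n ∈ Finset.range M, thermalRatio' sch k S n ^ t) ≤ C * Real.exp (-(Δth * (sch.a k * t)))

/-- **Subexponential renormalisations**: `|z_s(k)| + |shift_s(k)| ≤ e^{δ a_k L_k}` eventually, every `δ > 0`. -/
def SubexponentialRenormalisation' (sch : QCDScheme Nf) : Prop :=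
  ∀ (s : QCDField Nf) (δ : ℝ), 0 < δ →
    ∀ᶠ k in atTop, |sch.z s k| + |sch.shift s k| ≤ Real.exp (δ * (sch.a k * sch.L k))

end Summit.QuantumFields.QCD.Theorems.ConvergentOSClosure

end
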